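import Literature.Topology.FourManifolds.TrisectionsHeegaardSplitting
import Literature.Topology.FourManifolds.MorseLevelConnected
import HarnessLib

/-!
# Heegaard data of the trisection construction: the Heegaard function of the level, its genus
# bookkeeping and the connectedness of the Heegaard surface

Topic `Literature/Topology/FourManifolds`; instantiation infrastructure for the fact seat
`provefact-Literature.Topology.FourManifolds.exists_isBalancedGKTrisection` (Gay–Kirby 2016,
Thm. 4 via §4, Lemma 14).  Everything in this file is **proved**; no definitions, no named facts.

`TubeSystem.exists_heegaardFunction` (`TrisectionsHeegaardSplitting.lean`) is specialised to the
parameters used by the trisection construction (`0 < ε ≤ 1/100`, `δ = 1`, `κ = 1/(4η)`, so that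
`φ = 𝒯/7` wherever `𝒯 < 3` on the chart domains of the level, `b ∈ (1/2, 1)`), and completed
by the two pieces of bookkeeping the assembly needs (`exists_heegaardData`):

* **the genus relation** `gen + c₀(φ, <b) = c₁(φ, <b) + 1` for the common genus `gen` of the two
  handlebodies `{φ ≤ b}`, `{b ≤ φ}` (Milnor 1965, Thm. 8.1 Index 0 via
  `HasHandleDecomposition.exists_handleCount_one`, and `χ(Y³) = 0` via
  `IsMorse.ncard_inter_sub_eq_of_ordered`);
* **the Heegaard surface `φ⁻¹(b)` is connected** (`isConnected_level_of_connectedSpace_sublevel`: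
  the boundary of the connected handlebody `{φ ≤ b}`, all of whose handles have index `≤ 1`,
  i.e. coindex `≥ 2`, is connected — the tree's
  `IsMorseAdapted.isPreconnected_boundary_and_nonempty`).

## References

* D. Gay, R. Kirby, *Trisecting 4-manifolds*, Geom. Topol. 20 (2016), §4, Lemma 14. [GayKirby2016]
* J. Milnor, *Lectures on the h-cobordism theorem* (1965), Thms. 2.7, 4.8, 8.1. [MilnorHCobordism1965]
* J. Milnor, *Morse theory* (1963), §3. [Milnor1963]
-/

open scoped Manifold ContDiff Topology
open Set Function Filter Metric

noncomputable section

universe u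

namespace Literature.Topology.FourManifolds

/-! ### The level above a connected sublevel set with handles of coindex `≥ 2` is connected -/

section Level

variable {k : ℕ} [NeZero k] {M : Type u} [TopologicalSpace M] [T2Space M] [CompactSpace M]
  [ChartedSpace (EuclideanSpace ℝ (Fin (k + 1))) M] [IsManifold (𝓡 (k + 1)) ∞ M] {f : M → ℝ} {a : ℝ}

/-- **The regular level bounding a connected sublevel set all of whose critical points have
coindex `≥ 2` is connected** (it is the boundary of that handlebody). [cite: Milnor1963, Thms. 3.1–3.2, Rem. 3.3] -/
theorem isConnected_level_of_connectedSpace_sublevel (hf : IsMorse (𝓡 (k + 1)) f) (h : IsRegularLevel (𝓡 (k + 1)) f a)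
    [ConnectedSpace (RegularSublevel h)]
    (hidx : ∀ z, IsMCriticalPt (𝓡 (k + 1)) f z → f z ≤ a → morseIndex (𝓡 (k + 1)) f z + 2 ≤ k + 1) :
    IsConnected (f ⁻¹' {a}) := by
  set W : Type u := RegularSublevel h with hW
  haveI : LocallyPathConnectedSpace W := ChartedSpace.locallyPathConnectedSpace (EuclideanHalfSpace (k + 1)) W
  obtain ⟨hψ, hcrit, hind⟩ := RegularSublevel.morseData hf h
  set ι : W → M := RegularSublevel.incl h with hι
  have hidxψ : ∀ x : W, (𝓡∂ (k + 1)).IsInteriorPoint x →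
      IsMCriticalPt (𝓡∂ (k + 1)) (fun x : W => f (ι x) + (1 - a)) x →
      morseIndex (𝓡∂ (k + 1)) (fun x : W => f (ι x) + (1 - a)) x + 2 ≤ k + 1 := by
    intro x _ hx
    have hx' : IsMCriticalPt (𝓡 (k + 1)) f (ι x) := (hcrit x).1 hx
    rw [hind x hx']
    exact hidx (ι x) hx' (RegularSublevel.apply_incl_le h x)
  obtain ⟨hpre, hbne⟩ := hψ.isPreconnected_boundary_and_nonempty hidxψ
  have himage : ι '' ((𝓡∂ (k + 1)).boundary W) = f ⁻¹' {a} := by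
    ext y
    constructor
    · rintro ⟨x, hx, rfl⟩
      exact (RegularSublevel.mem_boundary_iff h x).1 hx
    · intro hy
      have hy' : f y = a := hy
      exact ⟨RegularSublevel.mk h y hy'.le, (RegularSublevel.mem_boundary_iff h _).2 hy', rfl⟩
  rw [← himage]
  exact ⟨hbne.image ι, hpre.image ι (RegularSublevel.continuous_incl h).continuousOn⟩

end Level

/-! ### The Heegaard data -/

variable {X : Type u} [TopologicalSpace X] [T2Space X] [SecondCountableTopology X] [CompactSpace X]
  [ChartedSpace (EuclideanSpace ℝ (Fin 4)) X] [IsManifold (𝓡 4) ∞ X]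

/-- On a regular level, `< b` and `≤ b` cut out the same critical points. [folklore] -/
theorem criticalSetOfIndex_inter_Iic_eq {N : Type u} [TopologicalSpace N] [ChartedSpace (EuclideanSpace ℝ (Fin 3)) N]
    {φ : N → ℝ} {b : ℝ} (hb : IsRegularLevel (𝓡 3) φ b) (i : ℕ) :
    criticalSetOfIndex (𝓡 3) φ i ∩ φ ⁻¹' Iic b = criticalSetOfIndex (𝓡 3) φ i ∩ φ ⁻¹' Iio b := by
  ext z
  simp only [mem_inter_iff, mem_preimage, mem_Iic, mem_Iio, and_congr_right_iff]
  intro hz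
  exact ⟨fun hle => lt_of_le_of_ne hle fun heq => hb.not_isMCriticalPt heq hz.1, le_of_lt⟩

/-- **The Heegaard data of the level `Y = f⁻¹(a)`** for the trisection construction: with the
tube system's parameters `0 < ε ≤ 1/100`, `δ = 1`, `κ = 1/(4η)` (admissible when `82η ≤ R²`), an
ordered Morse function `φ : Y → (0, 1)` with regular value `b ∈ (1/2, 1)` — index `≤ 1` below,
`≥ 2` above —, equal to `𝒯/7` on the chart domains of the level wherever the tube function is
`< 3`, whose two sides `{φ ≤ b}`, `{b ≤ φ}` are connected handlebodies with one `0`-handle and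
the same number `gen` of `1`-handles, `gen + c₀(φ, <b) = c₁(φ, <b) + 1`, and whose Heegaard
surface `φ⁻¹(b)` is connected. [cite: GayKirby2016, §4, Lemma 14 and proof of Thm. 4] [cite: MilnorHCobordism1965, Thms. 2.7, 4.8, 8.1] -/
theorem exists_heegaardData {f : X → ℝ} {a η : ℝ} {ι : Type} [Fintype ι]
    (TS : TubeSystem f a η ι) (h : IsRegularLevel (𝓡 4) f a) [ConnectedSpace (RegularLevel h)]
    (hηR : 82 * η ≤ TS.R ^ 2) {ε : ℝ} (hε : 0 < ε) (hε1 : ε ≤ 1 / 100) :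
    ∃ (φ : RegularLevel h → ℝ) (b : ℝ) (hb : IsRegularLevel (𝓡 3) φ b) (gen : ℕ),
      IsMorse (𝓡 3) φ ∧ (∀ y, φ y ∈ Ioo (0 : ℝ) 1) ∧ 1 / 2 < b ∧ b < 1 ∧
      (∀ z, IsMCriticalPt (𝓡 3) φ z → φ z < b → morseIndex (𝓡 3) φ z ≤ 1) ∧
      (∀ z, IsMCriticalPt (𝓡 3) φ z → b < φ z → 2 ≤ morseIndex (𝓡 3) φ z) ∧
      (∀ j (y : RegularLevel h), y.1 ∈ (TS.chart j).source →
        TubeModel.tube ε (1 / (4 * η)) η (TS.centred j y.1) < 3 →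
        φ y = (1 / 7) * TubeModel.tube ε (1 / (4 * η)) η (TS.centred j y.1)) ∧
      HasHandleDecomposition 2 (RegularSublevel hb) (handleCount 1 gen) ∧
      HasHandleDecomposition 2 (RegularSuperlevel hb) (handleCount 1 gen) ∧
      gen + (criticalSetOfIndex (𝓡 3) φ 0 ∩ φ ⁻¹' Iio b).ncard = (criticalSetOfIndex (𝓡 3) φ 1 ∩ φ ⁻¹' Iio b).ncard + 1 ∧
      IsConnected (φ ⁻¹' {b}) ∧ ConnectedSpace (RegularSublevel hb) ∧ ConnectedSpace (RegularSuperlevel hb) := by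
  have hη : 0 < η := TS.eta_pos
  have hε2 : ε ≤ 1 / 2 := by linarith
  have hκ : 0 < 1 / (4 * η) := by positivity
  have hδ : (0 : ℝ) < 1 := one_pos
  have hs : 3 * η / 2 + 2 * TubeSystem.rhoSq ε (1 / (4 * η)) 1 ≤ TS.R ^ 2 := by
    have : TubeSystem.rhoSq ε (1 / (4 * η)) 1 = 8 * η * (5 + ε) := by
      unfold TubeSystem.rhoSq; field_simp; ring
    rw [this]; nlinarith
  obtain ⟨φ, b, hb, hφM, hval, htb, hb1, hbelow, habove, hexpl, hconn₁, hconn₂, -⟩ :=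
    TS.exists_heegaardFunction (h := h) hs hε hε2 hκ hδ le_rfl
  have hbhalf : 1 / 2 < b := by norm_num at htb; linarith
  have hbreg : ∀ z, IsMCriticalPt (𝓡 3) φ z → φ z ≠ b := fun z hz heq => hb.not_isMCriticalPt heq hz
  -- extrema: nonemptiness of the two sides
  obtain ⟨zmin, -, hzmin⟩ := isCompact_univ.exists_isMinOn univ_nonempty hφM.contMDiff.continuous.continuousOn
  obtain ⟨zmax, -, hzmax⟩ := isCompact_univ.exists_isMaxOn univ_nonempty hφM.contMDiff.continuous.continuousOn
  have hminloc : IsLocalMin φ zmin := hzmin.isLocalMin univ_mem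
  have hmaxloc : IsLocalMax φ zmax := hzmax.isLocalMax univ_mem
  have hzmin_b : φ zmin < b := by
    have hcz : IsMCriticalPt (𝓡 3) φ zmin := IsLocalMin.isMCriticalPt hminloc
    have h0 := hφM.morseIndex_eq_zero_of_isLocalMin hminloc
    rcases lt_trichotomy (φ zmin) b with hlt | heq | hgt
    · exact hlt
    · exact absurd heq (hbreg zmin hcz)
    · have := habove zmin hcz hgt; omega
  have hzmax_b : b < φ zmax := by
    have hcz : IsMCriticalPt (𝓡 3) φ zmax := IsLocalMax.isMCriticalPt hmaxloc
    have h3 := hφM.morseIndex_eq_finrank_of_isLocalMax hmaxloc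
    rw [finrank_euclideanSpace_fin] at h3
    rcases lt_trichotomy (φ zmax) b with hlt | heq | hgt
    · have := hbelow zmax hcz hlt; omega
    · exact absurd heq (hbreg zmax hcz)
    · exact hgt
  haveI : Nonempty (RegularSublevel hb) := ⟨RegularSublevel.mk hb zmin hzmin_b.le⟩
  haveI : Nonempty (RegularSuperlevel hb) :=
    ⟨RegularSublevel.mk hb.const_sub zmax (by simp only [sub_nonpos]; exact hzmax_b.le)⟩
  haveI := hconn₁
  haveI := hconn₂
  -- the genus bookkeeping
  have hdec₁ : ∃ g₁, g₁ + (criticalSetOfIndex (𝓡 3) φ 0 ∩ φ ⁻¹' Iic b).ncard =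
      (criticalSetOfIndex (𝓡 3) φ 1 ∩ φ ⁻¹' Iic b).ncard + 1 ∧
      HasHandleDecomposition 2 (RegularSublevel hb) (handleCount 1 g₁) := by
    refine HasHandleDecomposition.exists_handleCount_one
      (RegularSublevel.hasHandleDecomposition hφM hb) (fun i hi => ?_)
    have hempty : criticalSetOfIndex (𝓡 3) φ i ∩ φ ⁻¹' Iic b = ∅ := by
      refine Set.eq_empty_of_forall_notMem fun z hz => ?_
      obtain ⟨⟨hzc, hzi⟩, hzb⟩ := hz
      have hzb' : φ z < b := lt_of_le_of_ne hzb (hbreg z hzc)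
      have h' : morseIndex (𝓡 3) φ z ≤ 1 := hbelow z hzc hzb'
      omega
    rw [hempty, Set.ncard_empty]
  have hφ' : IsMorse (𝓡 3) (fun y => b - φ y) := hφM.const_sub b
  have hdec₂ : ∃ g₂, g₂ + (criticalSetOfIndex (𝓡 3) (fun y => b - φ y) 0 ∩
        (fun y => b - φ y) ⁻¹' Iic 0).ncard =
      (criticalSetOfIndex (𝓡 3) (fun y => b - φ y) 1 ∩ (fun y => b - φ y) ⁻¹' Iic 0).ncard + 1 ∧
      HasHandleDecomposition 2 (RegularSuperlevel hb) (handleCount 1 g₂) := by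
    refine HasHandleDecomposition.exists_handleCount_one
      (RegularSublevel.hasHandleDecomposition hφ' hb.const_sub) (fun i hi => ?_)
    have hempty : criticalSetOfIndex (𝓡 3) (fun y => b - φ y) i ∩ (fun y => b - φ y) ⁻¹' Iic 0 = ∅ := by
      refine Set.eq_empty_of_forall_notMem fun z hz => ?_
      obtain ⟨⟨hzc, hzi⟩, hzb⟩ := hz
      have hzi' : morseIndex (𝓡 3) (fun y => b - φ y) z = i := hzi
      have hd : MDifferentiableAt (𝓡 3) 𝓘(ℝ, ℝ) φ z := hφM.contMDiff.mdifferentiableAt (by simp)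
      have hzc' : IsMCriticalPt (𝓡 3) φ z := (isMCriticalPt_const_sub_iff b hd).1 hzc
      have hsum := hφM.morseIndex_const_sub_add b hzc'
      rw [finrank_euclideanSpace_fin] at hsum
      have hsum' : morseIndex (𝓡 3) (fun y => b - φ y) z + morseIndex (𝓡 3) φ z = 3 := hsum
      have hzb' : b < φ z := by
        simp only [mem_preimage, mem_Iic, sub_nonpos] at hzb
        exact lt_of_le_of_ne hzb fun h' => hbreg z hzc' h'.symm
      have h' : 2 ≤ morseIndex (𝓡 3) φ z := habove z hzc' hzb'
      omega
    rw [hempty, Set.ncard_empty]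
  obtain ⟨g₁, hg₁, hd₁⟩ := hdec₁
  obtain ⟨g₂, hg₂, hd₂⟩ := hdec₂
  have hpre : (fun y => b - φ y) ⁻¹' Iic (0 : ℝ) = φ ⁻¹' Ici b := by
    ext z; simp only [mem_preimage, mem_Iic, mem_Ici, sub_nonpos]
  have hrank : Module.finrank ℝ (EuclideanSpace ℝ (Fin 3)) = 3 := finrank_euclideanSpace_fin
  have h0 : criticalSetOfIndex (𝓡 3) (fun y => b - φ y) 0 = criticalSetOfIndex (𝓡 3) φ 3 := by
    rw [hφM.criticalSetOfIndex_const_sub b (by rw [hrank]; norm_num), hrank]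
  have h1 : criticalSetOfIndex (𝓡 3) (fun y => b - φ y) 1 = criticalSetOfIndex (𝓡 3) φ 2 := by
    rw [hφM.criticalSetOfIndex_const_sub b (by rw [hrank]; norm_num), hrank]
  rw [hpre, h0, h1] at hg₂
  have hχ := hφM.ncard_inter_sub_eq_of_ordered hbelow habove
  have heq : g₁ = g₂ := by omega
  -- the level of `b` is connected
  have hlevel : IsConnected (φ ⁻¹' {b}) :=
    isConnected_level_of_connectedSpace_sublevel (k := 2) hφM hb fun z hz hzb => by
      have := hbelow z hz (lt_of_le_of_ne hzb (hbreg z hz))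
      change morseIndex (𝓡 3) φ z + 2 ≤ 3
      omega
  refine ⟨φ, b, hb, g₁, hφM, hval, hbhalf, hb1, hbelow, habove, fun j y hys hle => ?_, hd₁, heq ▸ hd₂, ?_, hlevel,
    hconn₁, hconn₂⟩
  · -- the tube form
    have hF : TS.heegaardFn ε (1 / (4 * η)) 1 y.1 = TubeModel.tube ε (1 / (4 * η)) η (TS.centred j y.1) :=
      TS.heegaardFn_eq_tube h.contMDiff hδ j y.2 hys (by linarith)
    have hlt : TS.heegaardFn ε (1 / (4 * η)) 1 y.1 < 1 + 2 * 1 := by rw [hF]; linarith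
    rw [hexpl y hlt, hF]; norm_num
  · rw [← criticalSetOfIndex_inter_Iic_eq hb 0, ← criticalSetOfIndex_inter_Iic_eq hb 1]; exact hg₁

end Literature.Topology.FourManifolds

end
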